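import Summits.ABC.StewartYu.PadicG3ParG
import HarnessLib

/-!
# Cell abc-stewartyu, Gen-3 record v2 (`PadicG3ParG`, K-M3.2): the sharp excess-gain bound at `m = 0` —
# `g^{n+1} ≤ K` (no `7^{n+1}`), the form clause (C) of the record needs

`Summits/ABC/StewartYu/PadicG3ParGPowG.lean` — cell `abc-stewartyu` (HOME `run/shared/lean/pub/abc-stewartyu/`),
route `PadicPrimesKummerThird`, crux `Y07Odd` (stmt-ABC-19658); seat lp-1 (g2).  Theorems only.

STATUS lp-1 2026-08-27T03:18Z: the (C) box line of the gain-divided record needs `gⁿ ≤ K` (the landed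
constant comparisons `RecordNumericC.nc1_nat/nc0_nat` are false with an extra `7^{n+1}`).  At `m = 0`
(the only regime where v2 is used): `G = θ₀ log p ≤ 2 log p`, so `g = G/(8(n+1)) ≤ log p/(4(n+1))`,
`(n+1) log g ≤ (n+1)(g−1) < log p/4`, hence `g^{4(n+1)} ≤ p ≤ (p−1)^4 ≤ K₀^4 = K^4` for `p ≥ 3`,
`K₀ ≥ p − 1`:

* `pow_g_four_le_p` — `m = 0 ⟹ (g^{n+1})^4 ≤ p`;
* `pow_g_le_K_of_m_zero` — `m = 0`, `3 ≤ p`, `p − 1 ≤ K₀ ⟹ g^{n+1} ≤ K` (hence also `gⁿ ≤ K`, `pow_g_le_K_of_m_zero'`).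

References: K. Yu, Acta Math. 211 (2013), §3.1 (3.5); Yu. V. Nesterenko, LNM 1819 (2003), §5.2.
-/

noncomputable section

open Real

namespace Summit.ABC.StewartYu

namespace PadicG3Par

variable {n : ℕ} (P : PadicG3Par n)

/-- `m = 0 ⟹ (g^{n+1})⁴ ≤ p`. [cite: Yu2013, §3.1 (3.5)] -/
theorem pow_g_four_le_p (hm : P.m = 0) : (P.g ^ (n + 1)) ^ 4 ≤ (P.p : ℝ) := by
  have hg1 := P.one_le_g
  have hlog := P.log_p_pos
  have hp : (0 : ℝ) < P.p := by have := P.two_le_p; positivity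
  -- `g ≤ log p / (4 (n+1))`
  have hG : P.G ≤ 2 * Real.log P.p := by
    unfold G θm; rw [hm]; push_cast
    have := P.hθ₀2; nlinarith
  have hg : 4 * ((n : ℝ) + 1) * P.g ≤ Real.log P.p := by
    unfold g cG
    rw [show 4 * ((n : ℝ) + 1) * (P.G / (8 * (n + 1))) = P.G / 2 by field_simp; ring]
    linarith
  -- `4 (n+1) log g ≤ 4 (n+1) (g - 1) < log p`
  have hlogg : Real.log P.g ≤ P.g - 1 := Real.log_le_sub_one_of_pos (by linarith)
  have hn : (0 : ℝ) ≤ 4 * ((n : ℝ) + 1) := by positivity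
  have h1 : (4 * ((n : ℝ) + 1)) * Real.log P.g ≤ Real.log P.p := by nlinarith
  have e : (P.g ^ (n + 1)) ^ 4 = Real.exp ((4 * ((n : ℝ) + 1)) * Real.log P.g) := by
    rw [← pow_mul, ← Real.exp_log (show 0 < P.g ^ ((n + 1) * 4) by positivity), Real.log_pow]
    push_cast; ring_nf
  rw [e, ← Real.exp_log hp]
  exact Real.exp_le_exp.mpr h1

/-- **`m = 0`, `3 ≤ p`, `p − 1 ≤ K₀ ⟹ g^{n+1} ≤ K`** — the sharp excess-gain bound for the (C) line.
[cite: Yu2013, §3.1 (3.5)] -/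
theorem pow_g_le_K_of_m_zero (hm : P.m = 0) (hp3 : 3 ≤ P.p) (hK₀ : (P.p : ℝ) - 1 ≤ P.K₀) :
    P.g ^ (n + 1) ≤ (P.K : ℝ) := by
  have h4 := P.pow_g_four_le_p hm
  have hg0 : 0 ≤ P.g ^ (n + 1) := by have := P.one_le_g; positivity
  have hp : (3 : ℝ) ≤ P.p := by exact_mod_cast hp3
  -- `p ≤ (p-1)^4`
  have hp4 : (P.p : ℝ) ≤ ((P.p : ℝ) - 1) ^ 4 := by
    have h2 : (2 : ℝ) ≤ (P.p : ℝ) - 1 := by linarith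
    have h8 : (2 : ℝ) ^ 3 ≤ ((P.p : ℝ) - 1) ^ 3 := pow_le_pow_left₀ (by norm_num) h2 3
    have e : ((P.p : ℝ) - 1) ^ 4 = ((P.p : ℝ) - 1) ^ 3 * ((P.p : ℝ) - 1) := by ring
    rw [e]; nlinarith
  have hK : ((P.p : ℝ) - 1) ≤ P.K := by
    have e : (P.K : ℝ) = P.K₀ := by unfold K; rw [hm]; push_cast; ring
    rw [e]; exact hK₀
  have hle : (P.g ^ (n + 1)) ^ 4 ≤ ((P.p : ℝ) - 1) ^ 4 := h4.trans hp4
  have hp1 : (0 : ℝ) ≤ (P.p : ℝ) - 1 := by linarith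
  exact ((pow_le_pow_iff_left₀ hg0 hp1 (by norm_num)).mp hle).trans hK

/-- `m = 0`, `3 ≤ p`, `p − 1 ≤ K₀ ⟹ gⁿ ≤ K`. [cite: Yu2013, §3.1 (3.5)] -/
theorem pow_g_le_K_of_m_zero' (hm : P.m = 0) (hp3 : 3 ≤ P.p) (hK₀ : (P.p : ℝ) - 1 ≤ P.K₀) :
    P.g ^ n ≤ (P.K : ℝ) :=
  (pow_le_pow_right₀ P.one_le_g (Nat.le_succ n)).trans (P.pow_g_le_K_of_m_zero hm hp3 hK₀)

end PadicG3Par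

end Summit.ABC.StewartYu

end
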